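import Literature.Geometry.Riemannian.MeanConvexProfile
import Literature.Geometry.Riemannian.MeanConvexPlanarZones
import Mathlib.Analysis.SpecialFunctions.Trigonometric.Bounds
import Mathlib.Analysis.Calculus.Deriv.Slope

/-!
# The planar junction profile of the surrounding construction

Topic `Geometry/Riemannian` (fact seat
`provefact-Literature.Geometry.Riemannian.LawsonMichelsohn1984_surrounding`).  Everything here
is **proved**; no definitions.

This file assembles the one-dimensional pieces of `MeanConvexProfile.lean` (angle profile `θ`,
height `τ`, chimney bend `ρ`, smooth steps) into the **planar profile** `Φ(r, t)` of the junction
in Lawson–Michelsohn's handle theorem (§3): in Fermi coordinates `r = dist(·, core disc)`,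
`t = height over Σ`, the new hypersurface is `{Φ(r, t) = 0}` near the attaching sphere.  `Φ` is
glued from the graph profile `t - τ(r)` (bending `Σ` up by the small angle `α`, then steepening to
`θ₁` close to the core, `MeanConvexPlanarZones`) and the chimney profile `tan θ₁ (r - ρ(t))`
(bending the cone `θ ≡ θ₁` into the vertical tube `r = r_tube`); the two coincide *as functions*
on the cone region, so every zero of `Φ` lies in an open set where `Φ` is one of the two models.

* `exists_junctionProfile` — for `k ≥ 2` there are constants `c_dom, C_r > 0` such that for all
  `h, ε, M > 0` there is a planar profile `Φ`, `C^∞` on `{r > 0}`, together with its scales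
  `tan α ≤ ε`, `r_tube < r₁ ≤ R₁ ≤ R₂ ≤ ε`, `0 < t_lo ≤ t₃ ≤ ε`, `(R₂ + t₃) tan α ≤ ε h R₁`, with:
  the exact forms `Φ = t` on `{r ≥ R₂, t ≤ t_lo}` and `Φ = tan θ₁ (r - r_tube)` on `{t ≥ t₃}`; the
  sign information (`Φ ≤ t` for `t ≤ t_lo`, `Φ < 0` for `r < r_tube`, `Φ > 0` on
  `{r ≥ r₁, t ≥ t_lo}` and on `{r ≥ R₂, t > 0}`, `Φ ≥ -1` on `{r ≤ r₁, t ≥ -1/2}`);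
  `Φ_r, Φ_t ≥ 0` on `{Φ ≤ 0}` (the transversality certificate); and at every zero the
  alternative **dominance** (`Q_k(Φ) ≥ c_dom (|Φ_rr| + |Φ_rt + Φ_tr| + |Φ_tt| + |Φ_r|/r)` and
  `Q_k(Φ) ≥ M`) **or far zone** (`r ≥ R₁`, `Φ_t = 1`, `0 ≤ Φ_r ≤ tan α`,
  `|Φ_rr| ≤ 8 (h + (k-1) tan α / R₁)`, `Φ_rt = Φ_tr = Φ_tt = 0`, `Q_k(Φ) ≥ -2h`), where `Q_k` is
  the flat frame sum of `MeanConvexFlatFrameSum.frameSum_biradial`.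

## References

* H. B. Lawson, Jr., M.-L. Michelsohn, *Embedding and surrounding with positive mean curvature*,
  Invent. Math. 77 (1984), Thm. 3.1 and its proof. [LawsonMichelsohn1984]
-/

noncomputable section

open Set Function Filter
open scoped Topology ContDiff

namespace Literature.Geometry.Riemannian

/-- If `y² ≤ A` and `1 ≤ A` then `y ≤ A`. [folklore] -/
theorem le_of_sq_le_of_one_le {y A : ℝ} (h : y ^ 2 ≤ A) (hA : 1 ≤ A) : y ≤ A := by
  by_contra hy
  push Not at hy
  have : A ^ 2 ≤ y ^ 2 := by nlinarith
  nlinarith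

set_option maxHeartbeats 1600000 in
/-- **The planar junction profile.**  See the module docstring.  The flat frame sum is written
out: with `Φr = DΦ(1,0)`, `Φt = DΦ(0,1)`, `Φrr = D²Φ(1,0)(1,0)`, `Φrt = D²Φ(1,0)(0,1)`,
`Φtr = D²Φ(0,1)(1,0)`, `Φtt = D²Φ(0,1)(0,1)` at `(r, t)`,
`Q = (Φrr Φt² - (Φrt + Φtr) Φr Φt + Φtt Φr²)/(Φr² + Φt²) + (k - 1) Φr / r`.
[cite: LawsonMichelsohn1984, Thm. 3.1] -/
theorem exists_junctionProfile (k : ℕ) (hk : 2 ≤ k) :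
    ∃ c_dom C_r : ℝ, 0 < c_dom ∧ 1 ≤ C_r ∧ ∀ h ε M : ℝ, 0 < h → 0 < ε → 0 < M →
      ∃ (Φ : ℝ × ℝ → ℝ) (tα c R₁ R₂ r₁ r_tube t_lo t₃ : ℝ),
        -- scales
        0 < tα ∧ tα ≤ ε ∧ 0 < c ∧ c ≤ C_r ∧ 0 < r_tube ∧ r_tube < r₁ ∧ r₁ ≤ R₁ ∧ R₁ ≤ R₂ ∧
        R₂ ≤ ε ∧ 0 < t_lo ∧ t_lo ≤ t₃ ∧ t₃ ≤ ε ∧ (R₂ + t₃) * tα ≤ ε * h * R₁ ∧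
        -- smoothness
        ContDiffOn ℝ ∞ Φ {p | 0 < p.1} ∧
        -- exact forms
        (∀ r t, R₂ ≤ r → t ≤ t_lo → Φ (r, t) = t) ∧
        (∀ r t, t₃ ≤ t → Φ (r, t) = c * (r - r_tube)) ∧
        -- signs
        (∀ r t, 0 < r → t ≤ t_lo → Φ (r, t) ≤ t) ∧
        (∀ r t, 0 < r → r < r_tube → Φ (r, t) < 0) ∧
        (∀ r t, r₁ ≤ r → t_lo ≤ t → 0 < Φ (r, t)) ∧
        (∀ r t, R₂ ≤ r → 0 < t → 0 < Φ (r, t)) ∧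
        (∀ r t, 0 < r → r ≤ r₁ → -(1 / 2 : ℝ) ≤ t → -1 ≤ Φ (r, t)) ∧
        -- certificate
        (∀ r t, 0 < r → Φ (r, t) ≤ 0 →
          0 ≤ fderiv ℝ Φ (r, t) (1, 0) ∧ 0 ≤ fderiv ℝ Φ (r, t) (0, 1) ∧
            (0 < fderiv ℝ Φ (r, t) (1, 0) ∨ 0 < fderiv ℝ Φ (r, t) (0, 1))) ∧
        -- frame sum at the zeros
        (∀ r t, 0 < r → Φ (r, t) = 0 →
          0 ≤ fderiv ℝ Φ (r, t) (1, 0) ∧ fderiv ℝ Φ (r, t) (1, 0) ≤ C_r ∧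
          0 ≤ fderiv ℝ Φ (r, t) (0, 1) ∧ fderiv ℝ Φ (r, t) (0, 1) ≤ 1 ∧
          (fderiv ℝ Φ (r, t) (1, 0) ≠ 0 ∨ fderiv ℝ Φ (r, t) (0, 1) ≠ 0) ∧
          ((c_dom * (|fderiv ℝ (fderiv ℝ Φ) (r, t) (1, 0) (1, 0)| +
                |fderiv ℝ (fderiv ℝ Φ) (r, t) (1, 0) (0, 1) +
                  fderiv ℝ (fderiv ℝ Φ) (r, t) (0, 1) (1, 0)| +
                |fderiv ℝ (fderiv ℝ Φ) (r, t) (0, 1) (0, 1)|) +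
              c_dom * |fderiv ℝ Φ (r, t) (1, 0)| / r ≤
              (fderiv ℝ (fderiv ℝ Φ) (r, t) (1, 0) (1, 0) * fderiv ℝ Φ (r, t) (0, 1) ^ 2 -
                  (fderiv ℝ (fderiv ℝ Φ) (r, t) (1, 0) (0, 1) +
                      fderiv ℝ (fderiv ℝ Φ) (r, t) (0, 1) (1, 0)) *
                    fderiv ℝ Φ (r, t) (1, 0) * fderiv ℝ Φ (r, t) (0, 1) +
                  fderiv ℝ (fderiv ℝ Φ) (r, t) (0, 1) (0, 1) * fderiv ℝ Φ (r, t) (1, 0) ^ 2) /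
                (fderiv ℝ Φ (r, t) (1, 0) ^ 2 + fderiv ℝ Φ (r, t) (0, 1) ^ 2) +
              (k - 1 : ℝ) * fderiv ℝ Φ (r, t) (1, 0) / r ∧
            M ≤ (fderiv ℝ (fderiv ℝ Φ) (r, t) (1, 0) (1, 0) * fderiv ℝ Φ (r, t) (0, 1) ^ 2 -
                  (fderiv ℝ (fderiv ℝ Φ) (r, t) (1, 0) (0, 1) +
                      fderiv ℝ (fderiv ℝ Φ) (r, t) (0, 1) (1, 0)) *
                    fderiv ℝ Φ (r, t) (1, 0) * fderiv ℝ Φ (r, t) (0, 1) +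
                  fderiv ℝ (fderiv ℝ Φ) (r, t) (0, 1) (0, 1) * fderiv ℝ Φ (r, t) (1, 0) ^ 2) /
                (fderiv ℝ Φ (r, t) (1, 0) ^ 2 + fderiv ℝ Φ (r, t) (0, 1) ^ 2) +
              (k - 1 : ℝ) * fderiv ℝ Φ (r, t) (1, 0) / r) ∨
          (R₁ ≤ r ∧ fderiv ℝ Φ (r, t) (0, 1) = 1 ∧ fderiv ℝ Φ (r, t) (1, 0) ≤ tα ∧
            |fderiv ℝ (fderiv ℝ Φ) (r, t) (1, 0) (1, 0)| ≤ 8 * (h + (k - 1 : ℝ) * tα / R₁) ∧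
            fderiv ℝ (fderiv ℝ Φ) (r, t) (1, 0) (0, 1) = 0 ∧
            fderiv ℝ (fderiv ℝ Φ) (r, t) (0, 1) (1, 0) = 0 ∧
            fderiv ℝ (fderiv ℝ Φ) (r, t) (0, 1) (0, 1) = 0 ∧
            -(2 * h) ≤ (fderiv ℝ (fderiv ℝ Φ) (r, t) (1, 0) (1, 0) * fderiv ℝ Φ (r, t) (0, 1) ^ 2 -
                  (fderiv ℝ (fderiv ℝ Φ) (r, t) (1, 0) (0, 1) +
                      fderiv ℝ (fderiv ℝ Φ) (r, t) (0, 1) (1, 0)) *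
                    fderiv ℝ Φ (r, t) (1, 0) * fderiv ℝ Φ (r, t) (0, 1) +
                  fderiv ℝ (fderiv ℝ Φ) (r, t) (0, 1) (0, 1) * fderiv ℝ Φ (r, t) (1, 0) ^ 2) /
                (fderiv ℝ Φ (r, t) (1, 0) ^ 2 + fderiv ℝ Φ (r, t) (0, 1) ^ 2) +
              (k - 1 : ℝ) * fderiv ℝ Φ (r, t) (1, 0) / r))) := by
  -- ### universal constants
  obtain ⟨K₀, hK₀1, hK₀⟩ := exists_deriv_smoothTransition_bound
  have hK₀pos : 0 < K₀ := by linarith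
  set κ : ℝ := (k : ℝ) - 1 with hκ
  have hk2 : (2 : ℝ) ≤ k := by exact_mod_cast hk
  have hκ1 : 1 ≤ κ := by rw [hκ]; linarith
  have hκpos : 0 < κ := by linarith
  set β' : ℝ := κ / 2 with hβ'
  have hβ'pos : 0 < β' := by positivity
  have hβ'κ : β' ≤ κ := by rw [hβ']; linarith
  set Tst : ℝ := 8 * K₀ / κ + 3 with hTst
  have hTst3 : 3 ≤ Tst := by
    rw [hTst]; have : 0 ≤ 8 * K₀ / κ := (by positivity); linarith only [this]
  have hTstpos : 0 < Tst := by linarith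
  set x : ℝ := 1 / (2 * (1 + Tst)) with hx
  have hxpos : 0 < x := by positivity
  have hx8 : x ≤ 1 / 8 := by
    rw [hx, div_le_div_iff₀ (by positivity) (by norm_num)]; linarith only [hTst3]
  set a₁ : ℝ := 1 - x with ha₁
  set b₁ : ℝ := 1 - x / 2 with hb₁
  have hab₁ : a₁ < b₁ := by rw [ha₁, hb₁]; linarith
  have hb₁1 : b₁ < 1 := by rw [hb₁]; linarith
  have ha₁pos : 1 / 2 < a₁ := by rw [ha₁]; linarith
  set c₀sq : ℝ := x / 2 with hc₀sq
  have hc₀sqpos : 0 < c₀sq := by positivity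
  set C_r : ℝ := 2 / x with hC_r
  have hC_r1 : 1 ≤ C_r := by rw [hC_r, le_div_iff₀ hxpos]; linarith
  have hC_rpos : 0 < C_r := by linarith
  set c_dom : ℝ := min (κ * c₀sq / (κ + 2 * c₀sq)) (κ / (κ + 2)) with hc_dom
  have hc_dompos : 0 < c_dom := lt_min (by positivity) (by positivity)
  have hc_dom1 : c_dom ≤ κ * c₀sq / (κ + 2 * c₀sq) := min_le_left _ _
  have hc_dom2 : c_dom ≤ κ / (κ + 2) := min_le_right _ _
  refine ⟨c_dom, C_r, hc_dompos, hC_r1, fun h ε M hh hε hM => ?_⟩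
  -- ### the scales
  have hκne : κ ≠ 0 := hκpos.ne'
  have hK₀ne : K₀ ≠ 0 := hK₀pos.ne'
  have hεne : ε ≠ 0 := hε.ne'
  have hhne : h ≠ 0 := hh.ne'
  have hMne : M ≠ 0 := hM.ne'
  have hxne : x ≠ 0 := hxpos.ne'
  set C₁ : ℝ := 2 + 2 * C_r + 2 * K₀ with hC₁
  have hC₁pos : 0 < C₁ := by positivity
  have hC₁ne : C₁ ≠ 0 := hC₁pos.ne'
  have hC₁1 : 1 ≤ C₁ := by rw [hC₁]; linarith only [hC_rpos, hK₀pos]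
  set a₂ : ℝ := min (min (min (a₁ / 2) (1 / 4)) (min (ε * h / (8 * C₁)) (ε / 4)))
    (min (min (κ * ε * h ^ 2 / (64 * C₁ * K₀ * M)) (ε ^ 2 * h ^ 2 / (64 * C₁ ^ 2 * K₀)))
      (min (ε * h / (8 * C₁ * K₀))
        (min (ε * h ^ 2 / (256 * C₁ * K₀ * C_r)) (h / (32 * K₀ * C_r))))) with ha₂
  have ha₂pos : 0 < a₂ := by
    simp only [ha₂, lt_min_iff]
    exact ⟨⟨⟨by linarith only [ha₁pos], by norm_num⟩, by positivity, by positivity⟩,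
      ⟨by positivity, by positivity⟩, by positivity, by positivity, by positivity⟩
  have ha₂ne : a₂ ≠ 0 := ha₂pos.ne'
  have ha₂1 : a₂ ≤ a₁ / 2 := (min_le_left _ _).trans ((min_le_left _ _).trans (min_le_left _ _))
  have ha₂2 : a₂ ≤ 1 / 4 := (min_le_left _ _).trans ((min_le_left _ _).trans (min_le_right _ _))
  have ha₂3 : a₂ ≤ ε * h / (8 * C₁) :=
    (min_le_left _ _).trans ((min_le_right _ _).trans (min_le_left _ _))
  have ha₂4 : a₂ ≤ ε / 4 := (min_le_left _ _).trans ((min_le_right _ _).trans (min_le_right _ _))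
  have ha₂5 : a₂ ≤ κ * ε * h ^ 2 / (64 * C₁ * K₀ * M) :=
    (min_le_right _ _).trans ((min_le_left _ _).trans (min_le_left _ _))
  have ha₂6 : a₂ ≤ ε ^ 2 * h ^ 2 / (64 * C₁ ^ 2 * K₀) :=
    (min_le_right _ _).trans ((min_le_left _ _).trans (min_le_right _ _))
  have ha₂7 : a₂ ≤ ε * h / (8 * C₁ * K₀) :=
    (min_le_right _ _).trans ((min_le_right _ _).trans (min_le_left _ _))
  have ha₂8 : a₂ ≤ ε * h ^ 2 / (256 * C₁ * K₀ * C_r) :=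
    (min_le_right _ _).trans ((min_le_right _ _).trans ((min_le_right _ _).trans (min_le_left _ _)))
  have ha₂9 : a₂ ≤ h / (32 * K₀ * C_r) :=
    (min_le_right _ _).trans ((min_le_right _ _).trans ((min_le_right _ _).trans (min_le_right _ _)))
  have ha₂le1 : a₂ ≤ 1 := by linarith only [ha₂2]
  have ha₂sq : a₂ ^ 2 ≤ a₂ := by nlinarith only [ha₂pos, ha₂le1]
  set b₂ : ℝ := 2 * a₂ with hb₂
  have hab₂ : a₂ < b₂ := by rw [hb₂]; linarith only [ha₂pos]
  have hba : b₂ ≤ a₁ := by rw [hb₂]; linarith only [ha₂1]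
  set r_f : ℝ := 16 * C₁ * K₀ * a₂ ^ (2 + 1 / β') / (ε * h ^ 2) with hr_f
  have hr_fpos : 0 < r_f := by
    rw [hr_f]; exact div_pos (mul_pos (by positivity) (Real.rpow_pos_of_pos ha₂pos _)) (by positivity)
  -- `R_α = 16 C₁ K₀ a₂² / (ε h²)`
  set R_α : ℝ := r_f * a₂ ^ (-(1 / β')) with hR_α
  have hR_αval : R_α = 16 * C₁ * K₀ * a₂ ^ 2 / (ε * h ^ 2) := by
    have e : a₂ ^ (2 + 1 / β') * a₂ ^ (-(1 / β')) = a₂ ^ 2 := by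
      rw [← Real.rpow_add ha₂pos, show (2 + 1 / β' + -(1 / β') : ℝ) = 2 by ring, Real.rpow_two]
    rw [hR_α, hr_f, div_mul_eq_mul_div, mul_assoc (16 * C₁ * K₀), e]
  have hR_αpos : 0 < R_α := by rw [hR_αval]; positivity
  -- ### the angle profile
  obtain ⟨θ, θ₁, α, L, hθc, hαpos, hαθ₁, hθ₁lt, hsinθ₁, hsinα, hL, hθI, hθanti, hθtop, hθα, hθ0,
    hθder, hθlow, hθbudget⟩ :=
    exists_angleProfile hK₀1 hK₀ hβ'pos hβ'κ hh hr_fpos ha₂pos hab₂ hba hab₁ hb₁1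
  have hθ₁pos : 0 < θ₁ := hαpos.trans_le hαθ₁
  have hαlt : α < Real.pi / 2 := hαθ₁.trans_lt hθ₁lt
  -- trigonometry of `θ₁` and `α`
  have hcosθ₁pos : 0 < Real.cos θ₁ :=
    Real.cos_pos_of_mem_Ioo ⟨by linarith only [hθ₁pos, Real.pi_pos], hθ₁lt⟩
  have hcosαpos : 0 < Real.cos α :=
    Real.cos_pos_of_mem_Ioo ⟨by linarith only [hαpos, Real.pi_pos], hαlt⟩
  have hsinθ₁nn : 0 ≤ Real.sin θ₁ := by linarith only [hsinθ₁.1, ha₁pos]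
  have hcos2θ₁ : c₀sq ≤ Real.cos θ₁ ^ 2 := by
    have h1 : Real.cos θ₁ ^ 2 = 1 - Real.sin θ₁ ^ 2 := by rw [← Real.sin_sq_add_cos_sq θ₁]; ring
    have h2 : Real.sin θ₁ ^ 2 ≤ b₁ := by
      nlinarith only [hsinθ₁.2, hb₁1, hsinθ₁nn, Real.sin_le_one θ₁]
    rw [h1, hc₀sq]; rw [hb₁] at h2; linarith only [h2, hc₀sq]
  have htan2θ₁ : Tst ≤ Real.tan θ₁ ^ 2 := by
    rw [Real.tan_eq_sin_div_cos, div_pow, le_div_iff₀ (pow_pos hcosθ₁pos 2)]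
    have h1 : Real.cos θ₁ ^ 2 = 1 - Real.sin θ₁ ^ 2 := by rw [← Real.sin_sq_add_cos_sq θ₁]; ring
    have h2 : a₁ ^ 2 ≤ Real.sin θ₁ ^ 2 := pow_le_pow_left₀ (by linarith only [ha₁pos]) hsinθ₁.1 2
    have h3 : 1 - 2 * x ≤ a₁ ^ 2 := by rw [ha₁]; nlinarith only [sq_nonneg x]
    have h5 : Tst * (2 * x) = 1 - 2 * x := by rw [hx]; field_simp; ring
    rw [h1]
    nlinarith only [h2, h3, h5, hTstpos, Real.sin_sq_le_one θ₁]
  have htanθ₁pos : 0 < Real.tan θ₁ := Real.tan_pos_of_pos_of_lt_pi_div_two hθ₁pos hθ₁lt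
  have htanθ₁1 : 1 ≤ Real.tan θ₁ := by nlinarith only [htan2θ₁, hTst3, htanθ₁pos]
  have htanθ₁le : Real.tan θ₁ ≤ C_r := by
    refine le_of_sq_le_of_one_le ?_ hC_r1
    rw [Real.tan_eq_sin_div_cos, div_pow, div_le_iff₀ (pow_pos hcosθ₁pos 2), hC_r]
    calc Real.sin θ₁ ^ 2 ≤ 1 := Real.sin_sq_le_one θ₁
      _ = 2 / x * (x / 2) := by field_simp
      _ ≤ 2 / x * Real.cos θ₁ ^ 2 := mul_le_mul_of_nonneg_left hcos2θ₁ (by positivity)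
  have hcot2θ₁ : 2 * K₀ / (Real.tan θ₁ ^ 2 * κ) ≤ 1 / 4 := by
    rw [div_le_div_iff₀ (by positivity) (by norm_num)]
    have : 8 * K₀ / κ ≤ Real.tan θ₁ ^ 2 := by
      have : 8 * K₀ / κ ≤ Tst := by rw [hTst]; norm_num
      exact this.trans htan2θ₁
    rw [div_le_iff₀ hκpos] at this
    linarith only [this]
  have hsinαle : Real.sin α ≤ 1 / 2 := by linarith only [hsinα.2, hb₂, ha₂2]
  have hsinαpos : 0 < Real.sin α := by linarith only [hsinα.1, ha₂pos]
  have hcosαge : 1 / 2 ≤ Real.cos α := by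
    have h1 : Real.cos α ^ 2 = 1 - Real.sin α ^ 2 := by rw [← Real.sin_sq_add_cos_sq α]; ring
    have h2 : Real.sin α ^ 2 ≤ 1 / 4 := by nlinarith only [hsinαle, hsinαpos]
    nlinarith only [h1, h2, hcosαpos]
  set tα : ℝ := Real.tan α with htα
  have htαpos : 0 < tα := Real.tan_pos_of_pos_of_lt_pi_div_two hαpos hαlt
  have htαle : tα ≤ 4 * a₂ := by
    rw [htα, Real.tan_eq_sin_div_cos, div_le_iff₀ hcosαpos]
    nlinarith only [hsinα.2, hb₂, hcosαge, ha₂pos]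
  have htαge : a₂ ≤ tα := by
    rw [htα, Real.tan_eq_sin_div_cos, le_div_iff₀ hcosαpos]
    nlinarith only [hsinα.1, Real.cos_le_one α, ha₂pos]
  have hαle : α ≤ 4 * a₂ := (Real.le_tan hαpos.le hαlt).trans htαle
  have htαθ₁ : tα ≤ Real.tan θ₁ :=
    Real.strictMonoOn_tan.monotoneOn ⟨by linarith only [hαpos, Real.pi_pos], hαlt⟩
      ⟨by linarith only [hθ₁pos, Real.pi_pos], hθ₁lt⟩ hαθ₁
  have htα1 : tα ≤ 1 := by linarith only [htαle, ha₂2]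
  -- the radii
  set R₁ : ℝ := 2 * R_α with hR₁
  set R₂ : ℝ := R₁ + L with hR₂
  have hLpos : 0 < L := by rw [hL]; positivity
  have hLle : L ≤ 4 * a₂ * K₀ / h := by
    rw [hL, div_le_div_iff₀ hh hh]; nlinarith only [hαle, mul_pos hK₀pos hh]
  have hR₁pos : 0 < R₁ := by positivity
  have hR₁ne : R₁ ≠ 0 := hR₁pos.ne'
  have hR₂pos : 0 < R₂ := by positivity
  have hR₁R₂ : R₁ ≤ R₂ := by linarith only [hLpos, hR₂]
  set r₁ : ℝ := r_f * b₁ ^ (-(1 / β')) with hr₁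
  have hb₁pos : 0 < b₁ := by linarith only [hab₁, ha₁pos]
  have hr₁pos : 0 < r₁ := mul_pos hr_fpos (Real.rpow_pos_of_pos hb₁pos _)
  have hr₁ne : r₁ ≠ 0 := hr₁pos.ne'
  have hr₁Rα : r₁ ≤ R_α := by
    rw [hr₁, hR_α]
    refine mul_le_mul_of_nonneg_left ?_ hr_fpos.le
    exact Real.rpow_le_rpow_of_nonpos ha₂pos (by linarith only [ha₂1, hab₁, ha₁pos])
      (by rw [neg_nonpos]; positivity)
  have hr₁R₁ : r₁ ≤ R₁ := by linarith only [hr₁Rα, hR₁, hR_αpos]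
  -- smallness of the radii
  have hR₁val : R₁ = 32 * C₁ * K₀ * a₂ ^ 2 / (ε * h ^ 2) := by rw [hR₁, hR_αval]; ring
  have hC₁R : C₁ * (R₁ + L) ≤ ε := by
    have h1 : C₁ * R₁ ≤ ε / 2 := by
      rw [hR₁val]
      have e : C₁ * (32 * C₁ * K₀ * a₂ ^ 2 / (ε * h ^ 2)) =
          32 * C₁ ^ 2 * K₀ * a₂ ^ 2 / (ε * h ^ 2) := by ring
      rw [e, div_le_iff₀ (by positivity)]
      have h6 := ha₂6
      rw [le_div_iff₀ (by positivity)] at h6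
      nlinarith only [h6, ha₂sq, mul_pos (pow_pos hC₁pos 2) hK₀pos, hε, hh]
    have h2 : C₁ * L ≤ ε / 2 := by
      have h7 := ha₂7
      rw [le_div_iff₀ (by positivity)] at h7
      calc C₁ * L ≤ C₁ * (4 * a₂ * K₀ / h) := mul_le_mul_of_nonneg_left hLle hC₁pos.le
        _ = 4 * (a₂ * (8 * C₁ * K₀)) / (8 * h) := by field_simp
        _ ≤ 4 * (ε * h) / (8 * h) := by gcongr
        _ = ε / 2 := by field_simp; ring
    linarith only [h1, h2]
  have hR₂ε : R₂ ≤ ε := by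
    have : R₂ ≤ C₁ * (R₁ + L) := by rw [hR₂]; nlinarith only [hC₁1, hR₁pos, hLpos]
    linarith only [this, hC₁R]
  have hRαC_r : R_α * C_r ≤ 1 / 16 := by
    rw [hR_αval]
    have h8 := ha₂8
    rw [le_div_iff₀ (by positivity)] at h8
    rw [div_mul_eq_mul_div, div_le_iff₀ (by positivity)]
    nlinarith only [h8, ha₂sq, mul_pos (mul_pos hC₁pos hK₀pos) hC_rpos, hε, hh]
  have hLC_r : L * C_r ≤ 1 / 8 := by
    have h9 := ha₂9
    rw [le_div_iff₀ (by positivity)] at h9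
    calc L * C_r ≤ 4 * a₂ * K₀ / h * C_r := mul_le_mul_of_nonneg_right hLle hC_rpos.le
      _ = 4 * (a₂ * (32 * K₀ * C_r)) / (32 * h) := by field_simp
      _ ≤ 4 * h / (32 * h) := by gcongr
      _ = 1 / 8 := by field_simp; ring
  have hMR : M ≤ κ / 2 * (a₂ / R₁) := by
    rw [hR₁val]
    have h5 := ha₂5
    rw [le_div_iff₀ (by positivity)] at h5
    rw [show κ / 2 * (a₂ / (32 * C₁ * K₀ * a₂ ^ 2 / (ε * h ^ 2))) =
      κ * ε * h ^ 2 / (64 * C₁ * K₀ * a₂) by field_simp; ring]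
    rw [le_div_iff₀ (by positivity)]
    linarith only [h5]
  -- ### the height profile and the cone
  have hθ0' : ∀ r, R₂ ≤ r → θ r = 0 := fun r hr => hθ0 r (by rw [hR₂, hR₁, hR_α] at hr; exact hr)
  obtain ⟨τ, hτc, hτder, hτ0, hτnn, hτle⟩ := exists_heightProfile hθc hθ₁lt hR₂pos hθI hθ0'
  set c : ℝ := Real.tan θ₁ with hcdef
  have hcpos : 0 < c := htanθ₁pos
  have hcne : c ≠ 0 := hcpos.ne'
  -- `τ` is affine with slope `-c` on `(0, r₁]`
  have hτcone : ∀ r, 0 < r → r ≤ r₁ → τ r = τ r₁ + (r₁ - r) * c := by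
    intro r hr hrr₁
    rcases eq_or_lt_of_le hrr₁ with h | h
    · rw [h]; ring
    · obtain ⟨ξ, hξ, hslope⟩ := exists_hasDerivAt_eq_slope τ (fun s => -Real.tan (θ s)) h
        (hτc.continuousOn.mono fun s hs => hr.trans_le hs.1)
        (fun s hs => hτder s (hr.trans hs.1))
      have hθξ : θ ξ = θ₁ := hθtop ξ (hr.trans hξ.1) hξ.2.le
      simp only [hθξ] at hslope
      rw [eq_div_iff (sub_ne_zero.2 h.ne')] at hslope
      rw [hcdef]; linarith only [hslope]
  -- `τ` is antitone on `(0, ∞)`, with `τ ≤ R₂ c`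
  have hτanti : AntitoneOn τ (Ioi 0) := by
    refine antitoneOn_of_deriv_nonpos (convex_Ioi 0) hτc.continuousOn
      (fun s hs => (hτder s (by rwa [interior_Ioi] at hs)).differentiableAt.differentiableWithinAt)
      fun s hs => ?_
    rw [interior_Ioi] at hs
    rw [(hτder s hs).deriv, neg_nonpos]
    exact Real.tan_nonneg_of_nonneg_of_le_pi_div_two (hθI s hs).1 ((hθI s hs).2.trans hθ₁lt.le)
  have hτbound : ∀ r, 0 < r → τ r ≤ R₂ * c := by
    intro r hr
    rcases le_or_gt r R₂ with h1 | h1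
    · exact (hτle r hr h1).trans (by nlinarith only [hcpos, hr])
    · rw [hτ0 r h1.le]; positivity
  have hR₂c : R₂ * c ≤ 1 / 4 := by
    have h1 : R₂ * c ≤ R₂ * C_r := mul_le_mul_of_nonneg_left htanθ₁le hR₂pos.le
    have h2 : R₂ * C_r = 2 * (R_α * C_r) + L * C_r := by rw [hR₂, hR₁]; ring
    linarith only [h1, h2, hRαC_r, hLC_r]
  have hr₁c : r₁ * c ≤ 1 / 16 := by
    have h1 : r₁ * c ≤ R_α * C_r := mul_le_mul hr₁Rα htanθ₁le hcpos.le hR_αpos.le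
    linarith only [h1, hRαC_r]
  -- ### the chimney
  set t_b : ℝ := τ r₁ with ht_b
  have ht_bnn : 0 ≤ t_b := hτnn r₁ hr₁pos
  have hr₁cpos : 0 < r₁ * c := mul_pos hr₁pos hcpos
  set t₂ : ℝ := t_b + r₁ * c / 4 with ht₂
  set T₁ : ℝ := 2 * r₁ * K₀ / (c * κ) with hT₁
  have hT₁pos : 0 < T₁ := by positivity
  set t₃ : ℝ := t₂ + T₁ with ht₃
  set t_lo : ℝ := t_b + r₁ * c / 16 with ht_lo
  set t_hi : ℝ := t_b + r₁ * c / 8 with ht_hi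
  have ht_lopos : 0 < t_lo := by positivity
  have hlohi : t_lo < t_hi := by rw [ht_lo, ht_hi]; linarith only [hr₁cpos]
  have hhi₂ : t_hi ≤ t₂ := by rw [ht_hi, ht₂]; linarith only [hr₁cpos]
  have hb₂' : t_b ≤ t₂ := by rw [ht₂]; linarith only [hr₁cpos]
  have h₂₃ : t₂ ≤ t₃ := by rw [ht₃]; linarith only [hT₁pos]
  obtain ⟨ρ, ρinf, hρc, hρline, hρder, hρ'I, hρtop, hρinf, hρle, hρge, hρder2, hρ''I⟩ :=
    exists_chimneyBend hK₀ (r_b := r₁) (t_b := t_b) hθ₁pos hθ₁lt hb₂' hT₁pos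
  have hcot : Real.cot θ₁ = c⁻¹ := by
    rw [Real.cot_eq_cos_div_sin, hcdef, Real.tan_eq_sin_div_cos, inv_div]
  have hcotnn : 0 ≤ Real.cot θ₁ := by rw [hcot]; positivity
  have hccot : c * Real.cot θ₁ = 1 := by rw [hcot, mul_inv_cancel₀ hcne]
  -- the bound `B = cot θ₁ K₀ / T₁ = κ / (2 r₁)`
  have hBval : Real.cot θ₁ * K₀ / T₁ = κ / (2 * r₁) := by
    rw [hcot, hT₁]; field_simp
  -- `r_tube = ρinf ∈ [r₁/2, 3 r₁/4]`
  have hρanti : Antitone ρ := antitone_of_deriv_nonpos (hρc.differentiable (by simp))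
    fun s => (hρ'I s).2
  have hρinf_ge : r₁ / 2 ≤ ρinf := by
    have h1 : Real.cot θ₁ * (t₂ + T₁ - t_b) = r₁ / 4 + r₁ * (2 * K₀ / (c ^ 2 * κ)) := by
      rw [hcot, ht₂, hT₁]; field_simp; ring
    have h2 : r₁ * (2 * K₀ / (c ^ 2 * κ)) ≤ r₁ / 4 := by
      have h3 : 2 * K₀ / (c ^ 2 * κ) ≤ 1 / 4 := hcot2θ₁
      nlinarith only [h3, hr₁pos]
    linarith only [hρinf, h1, h2]
  have hρinf_le : ρinf ≤ 3 * r₁ / 4 := by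
    have h1 : ρinf = ρ t₃ := (hρtop t₃ le_rfl).symm
    have h2 : ρ t₃ ≤ ρ t₂ := hρanti h₂₃
    have h3 : ρ t₂ = r₁ - r₁ / 4 := by
      rw [hρline t₂ le_rfl, ht₂]
      have : Real.cot θ₁ * (t_b + r₁ * c / 4 - t_b) = r₁ * (c * Real.cot θ₁) / 4 := by ring
      rw [this, hccot]; ring
    linarith only [h1, h2, h3]
  set r_tube : ℝ := ρinf with hr_tube
  have hr_tubepos : 0 < r_tube := by linarith only [hρinf_ge, hr₁pos]
  have hr_tube₁ : r_tube < r₁ := by linarith only [hρinf_le, hr₁pos]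
  -- `ρ ≥ r_tube` everywhere, `ρ ≤ r₁` on `[t_b, ∞)`, `ρ ≤ 15 r₁/16` on `[t_lo, ∞)`
  have hρ_ge : ∀ s, r_tube ≤ ρ s := fun s => by
    rcases hρge s with h1 | h1
    · exact h1
    · rw [hρline s (h1.trans hb₂')]
      have : Real.cot θ₁ * (s - t_b) ≤ 0 :=
        mul_nonpos_of_nonneg_of_nonpos hcotnn (by linarith only [h1])
      linarith only [this, hr_tube₁]
  have hρlo : ∀ s, t_lo ≤ s → ρ s ≤ 15 * r₁ / 16 := by
    intro s hs
    have h1 : ρ s ≤ ρ t_lo := hρanti hs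
    have h2 : ρ t_lo = r₁ - r₁ / 16 := by
      rw [hρline t_lo (hlohi.le.trans hhi₂), ht_lo]
      have : Real.cot θ₁ * (t_b + r₁ * c / 16 - t_b) = r₁ * (c * Real.cot θ₁) / 16 := by ring
      rw [this, hccot]; ring
    linarith only [h1, h2]
  -- ### the key identity on the cone region
  have hkey : ∀ r t, 0 < r → r ≤ r₁ → t ≤ t₂ → t - τ r = c * (r - ρ t) := by
    intro r t hr hrr₁ ht
    rw [hτcone r hr hrr₁, hρline t ht]
    have : c * (r - (r₁ - Real.cot θ₁ * (t - t_b))) = c * (r - r₁) + c * Real.cot θ₁ * (t - t_b) := by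
      ring
    rw [this, hccot, ht_b]; ring
  -- ### the blend and the profile
  obtain ⟨S, hSc, -, hS01, hS1, hS0, -, -⟩ := exists_stepDown hK₀ hlohi
  set Φ : ℝ × ℝ → ℝ := fun p => S p.2 * (p.2 - τ p.1) + (1 - S p.2) * (c * (p.1 - ρ p.2)) with hΦ
  set Φg : ℝ × ℝ → ℝ := fun p => p.2 - τ p.1 with hΦg
  set Φc : ℝ × ℝ → ℝ := fun p => c * (p.1 - ρ p.2) with hΦc
  have hΦ_g : ∀ p : ℝ × ℝ, p.2 ≤ t_lo → Φ p = Φg p := fun p hp => by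
    simp only [hΦ, hΦg, hS1 p.2 hp]; ring
  have hΦ_c : ∀ p : ℝ × ℝ, 0 < p.1 → p.1 ≤ r₁ → Φ p = Φc p := fun p hp1 hp2 => by
    rcases le_or_gt p.2 t₂ with h1 | h1
    · simp only [hΦ, hΦc, hkey p.1 p.2 hp1 hp2 h1]; ring
    · simp only [hΦ, hΦc, hS0 p.2 (hhi₂.trans h1.le)]; ring
  have hΦ_g_ev : ∀ r t, t < t_lo → Φ =ᶠ[𝓝 (r, t)] Φg := fun r t ht => by
    have ho : IsOpen {p : ℝ × ℝ | p.2 < t_lo} := isOpen_lt continuous_snd continuous_const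
    filter_upwards [ho.mem_nhds (show (r, t) ∈ {p : ℝ × ℝ | p.2 < t_lo} from ht)] with p hp
    exact hΦ_g p (le_of_lt hp)
  have hΦ_c_ev : ∀ r t, 0 < r → r < r₁ → Φ =ᶠ[𝓝 (r, t)] Φc := fun r t hr hrr₁ => by
    have ho : IsOpen {p : ℝ × ℝ | 0 < p.1 ∧ p.1 < r₁} :=
      (isOpen_lt continuous_const continuous_fst).inter (isOpen_lt continuous_fst continuous_const)
    filter_upwards [ho.mem_nhds (show (r, t) ∈ {p : ℝ × ℝ | 0 < p.1 ∧ p.1 < r₁} from ⟨hr, hrr₁⟩)]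
      with p hp
    exact hΦ_c p hp.1 hp.2.le
  have hD_g : ∀ r t, t < t_lo → fderiv ℝ Φ (r, t) = fderiv ℝ Φg (r, t) ∧
      fderiv ℝ (fderiv ℝ Φ) (r, t) = fderiv ℝ (fderiv ℝ Φg) (r, t) := fun r t ht =>
    ⟨(hΦ_g_ev r t ht).fderiv_eq, (hΦ_g_ev r t ht).fderiv.fderiv_eq⟩
  have hD_c : ∀ r t, 0 < r → r < r₁ → fderiv ℝ Φ (r, t) = fderiv ℝ Φc (r, t) ∧
      fderiv ℝ (fderiv ℝ Φ) (r, t) = fderiv ℝ (fderiv ℝ Φc) (r, t) := fun r t hr hrr₁ =>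
    ⟨(hΦ_c_ev r t hr hrr₁).fderiv_eq, (hΦ_c_ev r t hr hrr₁).fderiv.fderiv_eq⟩
  -- positivity on the quadrant `{r ≥ r₁, t ≥ t_lo}`
  have hquad : ∀ r t, r₁ ≤ r → t_lo ≤ t → 0 < Φ (r, t) := by
    intro r t hr ht
    have hrpos : 0 < r := hr₁pos.trans_le hr
    have h1 : c * r₁ / 16 ≤ t - τ r := by
      have : τ r ≤ τ r₁ := hτanti hr₁pos hrpos hr
      rw [ht_lo] at ht; rw [← ht_b] at this; linarith only [ht, this]
    have h2 : c * r₁ / 16 ≤ c * (r - ρ t) := by nlinarith only [hρlo t ht, hcpos, hr]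
    have hS := hS01 t
    show 0 < S t * (t - τ r) + (1 - S t) * (c * (r - ρ t))
    nlinarith only [hS.1, hS.2, hr₁cpos, h1, h2]
  have hregion : ∀ r t, 0 < r → Φ (r, t) ≤ 0 → t < t_lo ∨ r < r₁ := by
    intro r t hr hΦ0
    by_contra hcon
    push Not at hcon
    linarith only [hquad r t hcon.2 hcon.1, hΦ0]
  -- ### model-zone data
  have hcosθpos : ∀ r, 0 < r → 0 < Real.cos (θ r) := fun r hr =>
    Real.cos_pos_of_mem_Ioo ⟨by linarith only [(hθI r hr).1, Real.pi_pos], (hθI r hr).2.trans_lt hθ₁lt⟩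
  have hcosθge : ∀ r, 0 < r → Real.cos θ₁ ≤ Real.cos (θ r) := fun r hr =>
    Real.cos_le_cos_of_nonneg_of_le_pi (hθI r hr).1 (by linarith only [hθ₁lt, Real.pi_pos])
      (hθI r hr).2
  have hτev : ∀ r, 0 < r → ∀ᶠ s in 𝓝 r, HasDerivAt τ (-Real.tan (θ s)) s := fun r hr => by
    filter_upwards [isOpen_Ioi.mem_nhds hr] with s hs using hτder s hs
  have hθ'np : ∀ r, 0 < r → deriv θ r ≤ 0 := fun r hr => by
    rw [← derivWithin_of_mem_nhds (isOpen_Ioi.mem_nhds hr)]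
    exact hθanti.derivWithin_nonpos
  have htanθnn : ∀ r, 0 < r → 0 ≤ Real.tan (θ r) := fun r hr =>
    Real.tan_nonneg_of_nonneg_of_le_pi_div_two (hθI r hr).1 ((hθI r hr).2.trans hθ₁lt.le)
  have htanθle : ∀ r, 0 < r → Real.tan (θ r) ≤ c := fun r hr =>
    Real.strictMonoOn_tan.monotoneOn
      ⟨by linarith only [(hθI r hr).1, Real.pi_pos], (hθI r hr).2.trans_lt hθ₁lt⟩
      ⟨by linarith only [hθ₁pos, Real.pi_pos], hθ₁lt⟩ (hθI r hr).2
  have hsinθnn : ∀ r, 0 < r → 0 ≤ Real.sin (θ r) := fun r hr =>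
    Real.sin_nonneg_of_nonneg_of_le_pi (hθI r hr).1
      (by linarith only [(hθI r hr).2, hθ₁lt, Real.pi_pos])
  -- ### assembling the conclusions
  refine ⟨Φ, tα, c, R₁, R₂, r₁, r_tube, t_lo, t₃, htαpos, by linarith only [htαle, ha₂4], hcpos,
    htanθ₁le, hr_tubepos,
    hr_tube₁, hr₁R₁, hR₁R₂, hR₂ε, ht_lopos, ?_, ?_, ?_, ?_, ?_, ?_, ?_, ?_, hquad, ?_, ?_, ?_, ?_⟩
  · -- `t_lo ≤ t₃`
    rw [ht_lo, ht₃, ht₂]; linarith only [hr₁cpos, hT₁pos]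
  · -- `t₃ ≤ ε`
    have h1 : t_b ≤ R₂ * c := hτbound r₁ hr₁pos
    have hcκ : 1 ≤ c * κ := by nlinarith only [htanθ₁1, hκ1]
    have h2 : T₁ ≤ 2 * r₁ * K₀ := by
      rw [hT₁, div_le_iff₀ (by positivity)]; nlinarith only [hcκ, mul_pos hr₁pos hK₀pos]
    have h3 : R₂ * c ≤ (R₁ + L) * C_r := mul_le_mul_of_nonneg_left htanθ₁le hR₂pos.le
    have h4 : r₁ * c ≤ (R₁ + L) * C_r :=
      mul_le_mul (by linarith only [hr₁R₁, hLpos]) htanθ₁le hcpos.le (by linarith only [hR₁pos, hLpos])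
    have h7 : r₁ * K₀ ≤ (R₁ + L) * K₀ :=
      mul_le_mul_of_nonneg_right (by linarith only [hr₁R₁, hLpos]) hK₀pos.le
    have h5 : t₃ ≤ (R₁ + L) * (2 * C_r + 2 * K₀) := by
      rw [ht₃, ht₂]; linarith only [h1, h2, h3, h4, h7, hR₂, hr₁cpos]
    have h6 : (R₁ + L) * (2 * C_r + 2 * K₀) ≤ C₁ * (R₁ + L) := by
      rw [hC₁]; nlinarith only [hR₁pos, hLpos]
    linarith only [h5, h6, hC₁R]
  · -- `(R₂ + t₃) tα ≤ ε h R₁`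
    have h1 : t_b ≤ R₂ * c := hτbound r₁ hr₁pos
    have hcκ : 1 ≤ c * κ := by nlinarith only [htanθ₁1, hκ1]
    have h2 : T₁ ≤ 2 * r₁ * K₀ := by
      rw [hT₁, div_le_iff₀ (by positivity)]; nlinarith only [hcκ, mul_pos hr₁pos hK₀pos]
    have h3' : R₂ * c ≤ (R₁ + L) * C_r := mul_le_mul_of_nonneg_left htanθ₁le hR₂pos.le
    have h4' : r₁ * c ≤ (R₁ + L) * C_r :=
      mul_le_mul (by linarith only [hr₁R₁, hLpos]) htanθ₁le hcpos.le (by linarith only [hR₁pos, hLpos])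
    have h7 : r₁ * K₀ ≤ (R₁ + L) * K₀ :=
      mul_le_mul_of_nonneg_right (by linarith only [hr₁R₁, hLpos]) hK₀pos.le
    have h5' : t₃ ≤ (R₁ + L) * (2 * C_r + 2 * K₀) := by
      rw [ht₃, ht₂]; linarith only [h1, h2, h3', h4', h7, hR₂, hr₁cpos]
    have h3 : R₂ + t₃ ≤ C₁ * (R₁ + L) := by
      rw [hC₁]; nlinarith only [h5', hR₂, hR₁pos, hLpos]
    have h5 : C₁ * R₁ * tα ≤ ε * h * R₁ / 2 := by
      have h3'' := ha₂3
      rw [le_div_iff₀ (by positivity)] at h3''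
      have : C₁ * tα ≤ ε * h / 2 := by nlinarith only [htαle, hC₁pos, h3'']
      nlinarith only [this, hR₁pos]
    have h6 : C₁ * L * tα ≤ ε * h * R₁ / 2 := by
      calc C₁ * L * tα ≤ C₁ * (4 * a₂ * K₀ / h) * (4 * a₂) := by gcongr
        _ = 16 * C₁ * K₀ * a₂ ^ 2 / h := by field_simp; ring
        _ = ε * h * R₁ / 2 := by rw [hR₁val]; field_simp; ring
    calc (R₂ + t₃) * tα ≤ C₁ * (R₁ + L) * tα := mul_le_mul_of_nonneg_right h3 htαpos.le
      _ = C₁ * R₁ * tα + C₁ * L * tα := by ring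
      _ ≤ ε * h * R₁ := by linarith only [h5, h6]
  · -- smoothness
    have h1 : ContDiffOn ℝ ∞ (fun p : ℝ × ℝ => S p.2) {p | 0 < p.1} :=
      (hSc.comp contDiff_snd).contDiffOn
    have h2 : ContDiffOn ℝ ∞ (fun p : ℝ × ℝ => τ p.1) {p : ℝ × ℝ | 0 < p.1} :=
      hτc.comp contDiffOn_fst fun p hp => hp
    have h3 : ContDiffOn ℝ ∞ (fun p : ℝ × ℝ => ρ p.2) {p | 0 < p.1} :=
      (hρc.comp contDiff_snd).contDiffOn
    exact (h1.mul (contDiffOn_snd.sub h2)).add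
      ((contDiffOn_const.sub h1).mul (contDiffOn_const.mul (contDiffOn_fst.sub h3)))
  · -- `Φ = t` on `{r ≥ R₂, t ≤ t_lo}`
    intro r t hr ht
    rw [hΦ_g (r, t) ht]; simp [hΦg, hτ0 r hr]
  · -- `Φ = c (r - r_tube)` on `{t ≥ t₃}`
    intro r t ht
    have h1 : S t = 0 := hS0 t (by linarith only [ht, hhi₂, h₂₃])
    simp only [hΦ, h1, hρtop t ht]; ring
  · -- `Φ ≤ t` for `t ≤ t_lo`
    intro r t hr ht
    rw [hΦ_g (r, t) ht]; simp only [hΦg]; linarith only [hτnn r hr]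
  · -- `Φ < 0` for `r < r_tube`
    intro r t hr hrt
    rw [hΦ_c (r, t) hr (by linarith only [hrt, hr_tube₁])]
    simp only [hΦc]
    nlinarith only [hρ_ge t, hcpos, hrt]
  · -- `Φ > 0` on `{r ≥ R₂, t > 0}`
    intro r t hr ht
    rcases lt_or_ge t t_lo with h1 | h1
    · rw [hΦ_g (r, t) h1.le]; simp [hΦg, hτ0 r hr, ht]
    · exact hquad r t (by linarith only [hr, hR₁R₂, hr₁R₁]) h1
  · -- `Φ ≥ -1` on `{r ≤ r₁, t ≥ -1/2}`
    intro r t hr hrr₁ ht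
    rcases le_or_gt t t_lo with h1 | h1
    · rw [hΦ_g (r, t) h1]; simp only [hΦg]
      linarith only [hτbound r hr, hR₂c, ht]
    · rw [hΦ_c (r, t) hr hrr₁]; simp only [hΦc]
      have h2 : ρ t ≤ r₁ := hρle t (by rw [ht_lo] at h1; linarith only [h1, hr₁cpos])
      nlinarith only [h2, hr, hr₁c, hcpos]
  · -- certificate on `{Φ ≤ 0}`
    intro r t hr hΦ0
    rcases hregion r t hr hΦ0 with h1 | h1
    · obtain ⟨e1, e2, -, -, -, -⟩ :=
        graphProfile_derivs (t := t) (hτev r hr) (hθder r hr) (hcosθpos r hr).ne'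
      rw [(hD_g r t h1).1, e1, e2]
      exact ⟨htanθnn r hr, zero_le_one, Or.inr one_pos⟩
    · obtain ⟨e1, e2, -, -, -, -⟩ := chimneyProfile_derivs (r := r) (t := t) c hρder (hρder2 t)
      rw [(hD_c r t hr h1).1, e1, e2]
      refine ⟨hcpos.le, ?_, Or.inl hcpos⟩
      nlinarith only [(hρ'I t).2, hcpos]
  · -- the frame sum at the zeros
    intro r t hr hΦ0
    rcases hregion r t hr hΦ0.le with h1 | h1
    · -- graph zone: `Φ = t - τ r` near `(r, t)`
      obtain ⟨e1, e2, e3, e4, e5, e6⟩ :=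
        graphProfile_derivs (t := t) (hτev r hr) (hθder r hr) (hcosθpos r hr).ne'
      have hQ := frameSumQ_graphProfile (t := t) (hτev r hr) (hθder r hr) (hcosθpos r hr).ne' κ
      rw [(hD_g r t h1).1, (hD_g r t h1).2, e1, e2, e3, e4, e5, e6]
      rw [e1, e2, e3, e4, e5, e6] at hQ
      rw [hQ]
      refine ⟨htanθnn r hr, (htanθle r hr).trans htanθ₁le, zero_le_one, le_rfl,
        Or.inr one_ne_zero, ?_⟩
      have hcr := hcosθpos r hr
      have hθ' := hθ'np r hr
      rcases lt_or_ge r R₁ with h2 | h2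
      · -- zone ii: dominance
        left
        have hθge : α ≤ θ r := by
          have := hθanti hr (show (0 : ℝ) < R₁ from hR₁pos) h2.le
          rwa [hθα R₁ (show R_α ≤ R₁ by linarith only [hR₁, hR_αpos])
            (show R₁ ≤ 2 * R_α by linarith only [hR₁])] at this
        have htanθ : tα ≤ Real.tan (θ r) :=
          Real.strictMonoOn_tan.monotoneOn ⟨by linarith only [hαpos, Real.pi_pos], hαlt⟩
            ⟨by linarith only [(hθI r hr).1, Real.pi_pos], (hθI r hr).2.trans_lt hθ₁lt⟩ hθge
        have htanpos : 0 < Real.tan (θ r) := htαpos.trans_le htanθ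
        have hb := hθbudget r hr h2
        have hθ'ge : -(β' * Real.tan (θ r) / r) ≤ deriv θ r := by
          have h3 : -(β' * Real.sin (θ r) / r) ≤ Real.cos (θ r) * deriv θ r := by
            have e0 : (κ - β') * Real.sin (θ r) / r =
                κ * Real.sin (θ r) / r - β' * Real.sin (θ r) / r := by ring
            linarith only [hb, e0]
          have h4 : Real.cos (θ r) * (-(β' * Real.tan (θ r) / r)) = -(β' * Real.sin (θ r) / r) := by
            rw [Real.tan_eq_sin_div_cos]; field_simp
          by_contra hlt
          push Not at hlt
          have h5 := mul_lt_mul_of_pos_left hlt hcr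
          linarith only [h3, h4, h5]
        rw [hβ'] at hθ'ge
        set T : ℝ := Real.tan (θ r) with hT
        set d : ℝ := deriv θ r with hd
        have hcos2 : c₀sq ≤ Real.cos (θ r) ^ 2 :=
          hcos2θ₁.trans (pow_le_pow_left₀ hcosθ₁pos.le (hcosθge r hr) 2)
        have hTr : 0 < T / r := div_pos htanpos hr
        have e : κ / 2 * T / r = κ / 2 * (T / r) := by ring
        have e2 : κ * T / r = κ * (T / r) := by ring
        have hQlow : κ / 2 * (T / r) ≤ d + κ * T / r := by linarith only [hθ'ge, e, e2]
        constructor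
        · -- dominance
          have hP : 0 ≤ κ / 2 * (T / r) := by positivity
          have habs_d : |d / Real.cos (θ r) ^ 2| ≤ κ / 2 * (T / r) / c₀sq := by
            rw [abs_div, abs_of_pos (pow_pos hcr 2), abs_of_nonpos hθ']
            have h5 : -d ≤ κ / 2 * (T / r) := by linarith only [hθ'ge, e]
            exact div_le_div₀ hP h5 hc₀sqpos hcos2
          simp only [add_zero, abs_zero]
          rw [abs_of_pos htanpos]
          have A := mul_le_mul_of_nonneg_left habs_d hc_dompos.le
          have h8 : c_dom * ((κ + 2 * c₀sq) / (2 * c₀sq)) ≤ κ / 2 := by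
            have := hc_dom1
            rw [le_div_iff₀ (by positivity)] at this
            rw [← mul_div_assoc, div_le_iff₀ (by positivity)]
            linarith only [this]
          have B := mul_le_mul_of_nonneg_right h8 hTr.le
          have I : c_dom * (κ / 2 * (T / r) / c₀sq) + c_dom * (T / r) =
              c_dom * ((κ + 2 * c₀sq) / (2 * c₀sq)) * (T / r) := by field_simp
          have J : c_dom * T / r = c_dom * (T / r) := by ring
          linarith only [A, B, I, J, hQlow]
        · -- absolute lower bound `M`
          have h9 : κ / 2 * (a₂ / R₁) ≤ κ / 2 * (T / r) := by
            refine mul_le_mul_of_nonneg_left ?_ (by positivity)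
            calc a₂ / R₁ ≤ T / R₁ := div_le_div_of_nonneg_right (htαge.trans htanθ) hR₁pos.le
              _ ≤ T / r := div_le_div_of_nonneg_left htanpos.le hr h2.le
          linarith only [h9, hMR, hQlow]
      · -- far zone
        right
        have hθle : θ r ≤ α := by
          have := hθanti (show (0 : ℝ) < R_α from hR_αpos) hr
            (show R_α ≤ r by linarith only [h2, hR₁, hR_αpos])
          rwa [hθα R_α le_rfl (show R_α ≤ 2 * R_α by linarith only [hR_αpos])] at this
        have htanθα : Real.tan (θ r) ≤ tα :=
          Real.strictMonoOn_tan.monotoneOn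
            ⟨by linarith only [(hθI r hr).1, Real.pi_pos], (hθI r hr).2.trans_lt hθ₁lt⟩
            ⟨by linarith only [hαpos, Real.pi_pos], hαlt⟩ hθle
        have hsinle : Real.sin (θ r) ≤ tα := by
          have h3 : Real.sin (θ r) ≤ Real.tan (θ r) := by
            rw [Real.tan_eq_sin_div_cos, le_div_iff₀ hcr]
            nlinarith only [Real.cos_le_one (θ r), hsinθnn r hr]
          linarith only [h3, htanθα]
        have hcosge' : 1 / 2 ≤ Real.cos (θ r) := by
          have := Real.cos_le_cos_of_nonneg_of_le_pi (hθI r hr).1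
            (by linarith only [hαlt, Real.pi_pos]) hθle
          linarith only [this, hcosαge]
        have hlow := hθlow r hr
        refine ⟨h2, rfl, htanθα, ?_, rfl, rfl, rfl, ?_⟩
        · -- `|Φ_rr| ≤ 8 (h + κ tα / R₁)`
          rw [abs_div, abs_of_pos (pow_pos hcr 2), abs_of_nonpos hθ', div_le_iff₀ (pow_pos hcr 2)]
          set W : ℝ := h + κ * tα / R₁ with hW
          have h4 : κ * Real.sin (θ r) / r ≤ κ * tα / R₁ := by
            rw [div_le_div_iff₀ hr hR₁pos]
            calc κ * Real.sin (θ r) * R₁ ≤ κ * tα * R₁ := by gcongr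
              _ ≤ κ * tα * r := by gcongr
          have h5 : -deriv θ r * Real.cos (θ r) ≤ W := by linarith only [hlow, h4, hW]
          have h6 : 0 ≤ W := by rw [hW]; positivity
          have h7 : -deriv θ r ≤ 2 * W := by nlinarith only [h5, hcosge', hθ', h6]
          have hc2 : 1 / 4 ≤ Real.cos (θ r) ^ 2 := by nlinarith only [hcosge']
          have h8 : 2 * W ≤ 8 * W * Real.cos (θ r) ^ 2 := by nlinarith only [h6, hc2]
          linarith only [h7, h8]
        · -- `Q ≥ -2h`
          have h3 : -h / Real.cos (θ r) ≤ deriv θ r + κ * Real.tan (θ r) / r := by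
            rw [Real.tan_eq_sin_div_cos, div_le_iff₀ hcr]
            have e : (deriv θ r + κ * (Real.sin (θ r) / Real.cos (θ r)) / r) * Real.cos (θ r) =
                κ * Real.sin (θ r) / r + Real.cos (θ r) * deriv θ r := by field_simp; ring
            rw [e]; exact hlow
          have h4 : -(2 * h) ≤ -h / Real.cos (θ r) := by
            rw [le_div_iff₀ hcr]; nlinarith only [hcosge', hh]
          linarith only [h3, h4]
    · -- chimney zone: `Φ = c (r - ρ t)` near `(r, t)`
      obtain ⟨e1, e2, e3, e4, e5, e6⟩ := chimneyProfile_derivs (r := r) (t := t) c hρder (hρder2 t)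
      have hQ := frameSumQ_chimneyProfile (r := r) (t := t) c hcne hρder (hρder2 t) κ
      rw [(hD_c r t hr h1).1, (hD_c r t hr h1).2, e1, e2, e3, e4, e5, e6]
      rw [e1, e2, e3, e4, e5, e6] at hQ
      rw [hQ]
      have hρ' := hρ'I t
      have hρ'' := hρ''I t
      rw [hBval] at hρ''
      have hΦt0 : 0 ≤ -(c * deriv ρ t) := by nlinarith only [hρ'.2, hcpos]
      have hΦt1 : -(c * deriv ρ t) ≤ 1 := by
        have : -(c * deriv ρ t) ≤ c * Real.cot θ₁ := by nlinarith only [hρ'.1, hcpos]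
        linarith only [this, hccot]
      set ρ' : ℝ := deriv ρ t with hρ'def
      set ρ'' : ℝ := deriv (deriv ρ) t with hρ''def
      have hB0 : 0 ≤ κ / (2 * r₁) := by positivity
      have hfrac : ρ'' / (1 + ρ' ^ 2) ≤ κ / (2 * r₁) := by
        rw [div_le_iff₀ (by positivity)]
        nlinarith only [hρ''.1, hρ''.2, sq_nonneg ρ', hB0]
      have hr₁r : κ / (2 * r₁) ≤ κ / (2 * r) :=
        div_le_div_of_nonneg_left hκpos.le (by positivity) (by linarith only [h1])
      have h2r : 0 < κ / (2 * r) := by positivity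
      have hQlow : c * (κ / (2 * r)) ≤ c * (κ / r - ρ'' / (1 + ρ' ^ 2)) := by
        refine mul_le_mul_of_nonneg_left ?_ hcpos.le
        have e : κ / r = κ / (2 * r) + κ / (2 * r) := by field_simp; ring
        linarith only [hfrac, hr₁r, e]
      refine ⟨hcpos.le, htanθ₁le, hΦt0, hΦt1, Or.inl hcne, Or.inl ⟨?_, ?_⟩⟩
      · -- dominance
        simp only [abs_zero, zero_add, abs_neg]
        rw [abs_of_nonneg (by nlinarith only [hρ''.1, hcpos] : 0 ≤ c * ρ''), abs_of_pos hcpos]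
        have h3 : c * ρ'' ≤ c * (κ / (2 * r)) := mul_le_mul_of_nonneg_left (hρ''.2.trans hr₁r) hcpos.le
        have h4 : c_dom * (c * ρ'') ≤ c_dom * (c * (κ / (2 * r))) :=
          mul_le_mul_of_nonneg_left h3 hc_dompos.le
        have h5 : c_dom * (c * (κ / (2 * r))) + c_dom * (c / r) = c_dom * ((κ + 2) / 2) * (c / r) := by
          field_simp
        have h6 : c_dom * ((κ + 2) / 2) ≤ κ / 2 := by
          have := hc_dom2; rw [le_div_iff₀ (by positivity)] at this
          linarith only [this]
        have h7 : c_dom * ((κ + 2) / 2) * (c / r) ≤ κ / 2 * (c / r) :=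
          mul_le_mul_of_nonneg_right h6 (by positivity)
        have h8 : κ / 2 * (c / r) = c * (κ / (2 * r)) := by field_simp
        have h9 : c_dom * c / r = c_dom * (c / r) := by ring
        linarith only [h4, h5, h7, h8, h9, hQlow]
      · -- absolute lower bound `M`
        have h3 : κ / 2 * (a₂ / R₁) ≤ κ / R₁ := by
          rw [show κ / 2 * (a₂ / R₁) = (a₂ / 2) * (κ / R₁) by ring]
          exact mul_le_of_le_one_left (by positivity) (by linarith only [ha₂le1])
        have h4 : κ / R₁ ≤ κ / (2 * r) :=
          div_le_div_of_nonneg_left hκpos.le (by positivity) (by linarith only [h1, hr₁Rα, hR₁])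
        have h5 : κ / (2 * r) ≤ c * (κ / (2 * r)) := le_mul_of_one_le_left h2r.le htanθ₁1
        linarith only [hMR, h3, h4, h5, hQlow]

end Literature.Geometry.Riemannian

end
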